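import Mathlib
import Literature.Analysis.Calculus.IntervalCauchySchwarz
import Literature.Analysis.PDE.Wave1DSourceEnergy
import Literature.Analysis.PDE.Wave1DExteriorEnergy
import Literature.Analysis.PDE.Wave1DFarEnergySourced
import HarnessLib

/-!
# Duhamel-type energy bound for `ψ_tt − ψ_xx + V(x)ψ = F` with NON-ZERO Cauchy data

Analysis/PDE support file (everything proved, no definitions). The companion of
`Wave1DDuhamelBound.lean` / `Wave1DFarConeDuhamel.lean` without the zero-data hypothesis: for a `C²`
solution of the sourced 1+1 wave equation (continuous `V ≥ 0`, `F`) the energy on the top of the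
characteristic trapezoid obeys

  `E(t) ≤ (√E(0) + 2 ∫_0^t k)²`,   `k(τ) = √(∫_{a+τ}^{b−τ} F(τ,·)²)`     (`wave1D_trapezoid_energy_le_of_data`),

(energy inequality `E(τ) − E(0) ≤ 2∫_0^τ √E k`, maximum of `E` on `[0, t]`, and the quadratic
inequality `M ≤ E(0) + 2K√M ⇒ √M ≤ √E(0) + 2K`), and its `b → ∞` far-cone form with lower Lebesgue
integrals and a continuous majorant `m ≥ k`

  `∫⁻_{x>a+t} e(t,·) ≤ ofReal ((√E₀ + 2∫_0^t m)²)`,  `E₀ = ∫_{x>a} e(0,·)`   (`wave1D_farCone_energy_le_of_data`),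

plus the time-reversed statement. This lets one compare two evolutions whose data differ by a
SMALL-energy (not zero, not compactly supported) tail without solving a Cauchy problem for the tail —
the comparison step of the far-side channel estimate of `FixedModeChannels` (route PhotonSphereChannels,
stmt-FinalStateConjecture-10048). References: F. John, *PDE*, Ch. 5; Evans, *PDE*, §2.4.3; folklore.
-/

noncomputable section

namespace Literature.Analysis.PDE

open MeasureTheory Set Filter Topology intervalIntegral Literature.Analysis.Calculus

variable {V : ℝ → ℝ} {F ψ : ℝ → ℝ → ℝ}

/-- The quadratic absorption step: `0 ≤ M ≤ E₀ + 2K√M` with `E₀, K ≥ 0` gives `√M ≤ √E₀ + 2K`.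
[folklore] -/
theorem sqrt_le_of_le_add_mul_sqrt {M E₀ K : ℝ} (hM : 0 ≤ M) (hE : 0 ≤ E₀) (hK : 0 ≤ K)
    (h : M ≤ E₀ + 2 * K * Real.sqrt M) : Real.sqrt M ≤ Real.sqrt E₀ + 2 * K := by
  set s : ℝ := Real.sqrt M with hs
  have hs0 : 0 ≤ s := Real.sqrt_nonneg _
  have hss : s * s = M := Real.mul_self_sqrt hM
  set r : ℝ := Real.sqrt E₀ with hr
  have hr0 : 0 ≤ r := Real.sqrt_nonneg _
  have hrr : r * r = E₀ := Real.mul_self_sqrt hE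
  by_contra hlt
  push Not at hlt
  -- `s > r + 2K` ⇒ `(s − K)² > (r + K)² ≥ r² + ... ` ⇒ contradiction
  nlinarith [mul_nonneg hr0 hK]

/-- **Energy bound for the inhomogeneous equation with general data on a trapezoid.** See the module
docstring. [folklore] -/
theorem wave1D_trapezoid_energy_le_of_data (hV : Continuous V) (hV0 : ∀ x, 0 ≤ V x)
    (hF : Continuous (Function.uncurry F)) (hψ : ContDiff ℝ 2 (Function.uncurry ψ))
    (hsol : ∀ t x, iteratedDeriv 2 (fun τ => ψ τ x) t - iteratedDeriv 2 (ψ t) x + V x * ψ t x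
      = F t x)
    {a b t : ℝ} (ht : 0 ≤ t) (hab : a + t ≤ b - t) :
    (∫ x in (a + t)..(b - t),
        (deriv (fun τ => ψ τ x) t ^ 2 + deriv (ψ t) x ^ 2 + V x * ψ t x ^ 2))
      ≤ (Real.sqrt (∫ x in a..b,
            (deriv (fun τ => ψ τ x) 0 ^ 2 + deriv (ψ 0) x ^ 2 + V x * ψ 0 x ^ 2))
          + 2 * ∫ τ in (0 : ℝ)..t, Real.sqrt (∫ x in (a + τ)..(b - τ), F τ x ^ 2)) ^ 2 := by
  obtain ⟨ψt, ψx, ψtt, ψtx, ψxx, hct, hcx, -, -, -, h1, h2, -⟩ := exists_partials_of_contDiff_two hψ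
  have hd1 : ∀ t x, deriv (fun τ => ψ τ x) t = ψt t x := fun t x => (h1 t x).deriv
  set E : ℝ → ℝ := fun τ => ∫ x in (a + τ)..(b - τ),
    (deriv (fun σ => ψ σ x) τ ^ 2 + deriv (ψ τ) x ^ 2 + V x * ψ τ x ^ 2) with hE
  set k : ℝ → ℝ := fun τ => Real.sqrt (∫ x in (a + τ)..(b - τ), F τ x ^ 2) with hk
  have he_cont : Continuous (Function.uncurry fun τ x =>
      deriv (fun σ => ψ σ x) τ ^ 2 + deriv (ψ τ) x ^ 2 + V x * ψ τ x ^ 2) :=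
    continuous_wave1D_energyDensity hV hψ
  have hcont2 : ∀ {φ : ℝ → ℝ → ℝ}, Continuous (Function.uncurry φ) →
      ∀ {u v : ℝ → ℝ}, Continuous u → Continuous v → Continuous fun y => φ (u y) (v y) :=
    fun hφ u v hu hv => hφ.comp (hu.prodMk hv)
  have hparam : ∀ {φ : ℝ → ℝ → ℝ}, Continuous (Function.uncurry φ) →
      Continuous fun τ => ∫ x in (a + τ)..(b - τ), φ τ x := by
    intro φ hφ
    have hP := intervalIntegral.continuous_parametric_primitive_of_continuous (μ := volume)
      (a₀ := (0 : ℝ)) hφ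
    have c1 : Continuous fun τ : ℝ => ∫ x in (0 : ℝ)..(b - τ), φ τ x :=
      hP.comp (continuous_id.prodMk (continuous_const.sub continuous_id))
    have c2 : Continuous fun τ : ℝ => ∫ x in (0 : ℝ)..(a + τ), φ τ x :=
      hP.comp (continuous_id.prodMk (continuous_const.add continuous_id))
    have heq : (fun τ => ∫ x in (a + τ)..(b - τ), φ τ x)
        = fun τ => (∫ x in (0 : ℝ)..(b - τ), φ τ x) - ∫ x in (0 : ℝ)..(a + τ), φ τ x := by
      funext τ
      have i1 : IntervalIntegrable (fun x => φ τ x) volume 0 (b - τ) :=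
        (hcont2 hφ continuous_const continuous_id).intervalIntegrable _ _
      have i2 : IntervalIntegrable (fun x => φ τ x) volume 0 (a + τ) :=
        (hcont2 hφ continuous_const continuous_id).intervalIntegrable _ _
      exact (integral_interval_sub_left i1 i2).symm
    rw [heq]
    exact c1.sub c2
  have hE_cont : Continuous E := hparam he_cont
  have hF2_cont : Continuous (Function.uncurry fun τ x => F τ x ^ 2) := by
    show Continuous fun p : ℝ × ℝ => F p.1 p.2 ^ 2
    have : Continuous fun p : ℝ × ℝ => F p.1 p.2 := hF
    fun_prop
  have hk_cont : Continuous k := Real.continuous_sqrt.comp (hparam hF2_cont)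
  have hk0 : ∀ τ, 0 ≤ k τ := fun τ => Real.sqrt_nonneg _
  have hab0 : a ≤ b := by linarith
  -- non-negativity of the energies
  have hEnn : ∀ τ ∈ Icc 0 t, 0 ≤ E τ := by
    intro τ hτ
    have hτab : a + τ ≤ b - τ := by linarith [hτ.2]
    exact intervalIntegral.integral_nonneg hτab fun x _ => wave1D_energyDensity_nonneg hV0 τ x
  have hE00 : 0 ≤ E 0 := hEnn 0 ⟨le_rfl, ht⟩
  have hE0eq : E 0 = ∫ x in a..b,
      (deriv (fun τ => ψ τ x) 0 ^ 2 + deriv (ψ 0) x ^ 2 + V x * ψ 0 x ^ 2) := by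
    simp only [hE, add_zero, sub_zero]
  -- the energy inequality from `0` to `τ ∈ [0, t]`
  have hstep : ∀ τ ∈ Icc 0 t, E τ ≤ E 0 + 2 * ∫ σ in (0 : ℝ)..τ, Real.sqrt (E σ) * k σ := by
    intro τ hτ
    have hτab : a + τ ≤ b - τ := by linarith [hτ.2]
    have h := wave1D_trapezoid_energy_sub_le_source hV hV0 hF hψ hsol hτ.1 hτab
    simp only [add_zero, sub_zero] at h
    have h' : E τ - E 0 ≤ 2 * ∫ σ in (0 : ℝ)..τ, ∫ x in (a + σ)..(b - σ),
        deriv (fun σ' => ψ σ' x) σ * F σ x := by simpa [hE] using h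
    have hmono : (∫ σ in (0 : ℝ)..τ, ∫ x in (a + σ)..(b - σ), deriv (fun σ' => ψ σ' x) σ * F σ x)
        ≤ ∫ σ in (0 : ℝ)..τ, Real.sqrt (E σ) * k σ := by
      refine intervalIntegral.integral_mono_on hτ.1 ?_ ?_ fun σ hσ => ?_
      · exact (hparam (by
          show Continuous fun p : ℝ × ℝ => deriv (fun σ' => ψ σ' p.2) p.1 * F p.1 p.2
          simp only [hd1]
          have ha : Continuous fun p : ℝ × ℝ => ψt p.1 p.2 := hct
          have hb : Continuous fun p : ℝ × ℝ => F p.1 p.2 := hF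
          fun_prop)).intervalIntegrable _ _
      · exact ((Real.continuous_sqrt.comp hE_cont).mul hk_cont).intervalIntegrable _ _
      · have hσab : a + σ ≤ b - σ := by linarith [hσ.2, hτ.2]
        have hcs := abs_intervalIntegral_mul_le_sqrt (f := fun x => deriv (fun σ' => ψ σ' x) σ)
          (g := fun x => F σ x) (by simp only [hd1]; exact hcont2 hct continuous_const continuous_id)
          (hcont2 hF continuous_const continuous_id) hσab
        refine (le_abs_self _).trans (hcs.trans ?_)
        refine mul_le_mul_of_nonneg_right (Real.sqrt_le_sqrt ?_) (hk0 σ)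
        refine intervalIntegral.integral_mono_on hσab ?_ ?_ fun x _ => ?_
        · exact ((by simp only [hd1]; exact hcont2 hct continuous_const continuous_id :
            Continuous fun x => deriv (fun σ' => ψ σ' x) σ).pow 2).intervalIntegrable _ _
        · exact (hcont2 he_cont continuous_const continuous_id).intervalIntegrable _ _
        · have := hV0 x
          nlinarith [sq_nonneg (deriv (ψ σ) x), mul_nonneg this (sq_nonneg (ψ σ x))]
    linarith
  -- maximum of `E` on `[0, t]`
  obtain ⟨τ₀, hτ₀, hmax⟩ := isCompact_Icc.exists_isMaxOn (nonempty_Icc.2 ht) hE_cont.continuousOn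
  set Mx : ℝ := E τ₀ with hMx
  have hEle : ∀ τ ∈ Icc 0 t, E τ ≤ Mx := fun τ hτ => hmax hτ
  have hM0 : 0 ≤ Mx := hEnn τ₀ hτ₀
  set K : ℝ := ∫ τ in (0 : ℝ)..t, k τ with hK
  have hKmono : (∫ σ in (0 : ℝ)..τ₀, k σ) ≤ K :=
    intervalIntegral.integral_mono_interval le_rfl hτ₀.1 hτ₀.2 (Eventually.of_forall hk0)
      (hk_cont.intervalIntegrable _ _)
  have hK0 : 0 ≤ K := intervalIntegral.integral_nonneg ht fun τ _ => hk0 τ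
  -- `Mx ≤ E 0 + 2 K √Mx`
  have hkey : Mx ≤ E 0 + 2 * K * Real.sqrt Mx := by
    have h := hstep τ₀ hτ₀
    have h2 : (∫ σ in (0 : ℝ)..τ₀, Real.sqrt (E σ) * k σ) ≤ ∫ σ in (0 : ℝ)..τ₀, Real.sqrt Mx * k σ := by
      refine intervalIntegral.integral_mono_on hτ₀.1
        (((Real.continuous_sqrt.comp hE_cont).mul hk_cont).intervalIntegrable _ _)
        ((continuous_const.mul hk_cont).intervalIntegrable _ _) fun σ hσ => ?_
      exact mul_le_mul_of_nonneg_right (Real.sqrt_le_sqrt (hEle σ ⟨hσ.1, hσ.2.trans hτ₀.2⟩))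
        (hk0 σ)
    rw [intervalIntegral.integral_const_mul] at h2
    nlinarith [Real.sqrt_nonneg Mx]
  have hsqrt : Real.sqrt Mx ≤ Real.sqrt (E 0) + 2 * K := sqrt_le_of_le_add_mul_sqrt hM0 hE00 hK0 hkey
  have hMle : Mx ≤ (Real.sqrt (E 0) + 2 * K) ^ 2 := by
    calc Mx = Real.sqrt Mx ^ 2 := (Real.sq_sqrt hM0).symm
      _ ≤ (Real.sqrt (E 0) + 2 * K) ^ 2 := pow_le_pow_left₀ (Real.sqrt_nonneg _) hsqrt 2
  have := (hEle t ⟨ht, le_rfl⟩).trans hMle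
  rw [hE0eq] at this
  exact this

/-- **Far-cone energy bound with general data, forward in time.** With `E₀ = ∫_{x>a} e(0,·)`
(finite: integrability assumed) and a continuous majorant `m` of the sliced source norms:
`∫⁻_{x>a+t} e(t,·) ≤ ofReal ((√E₀ + 2∫_0^t m)²)` for `t ≥ 0`. [folklore] -/
theorem wave1D_farCone_energy_le_of_data (hV : Continuous V) (hV0 : ∀ x, 0 ≤ V x)
    (hF : Continuous (Function.uncurry F)) (hψ : ContDiff ℝ 2 (Function.uncurry ψ))
    (hsol : ∀ t x, iteratedDeriv 2 (fun τ => ψ τ x) t - iteratedDeriv 2 (ψ t) x + V x * ψ t x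
      = F t x)
    {a : ℝ} (hint : IntegrableOn (fun x => deriv (fun τ => ψ τ x) 0 ^ 2 + deriv (ψ 0) x ^ 2
      + V x * ψ 0 x ^ 2) (Ioi a))
    {m : ℝ → ℝ} (hm : Continuous m)
    (hmb : ∀ τ, 0 ≤ τ → ∀ b, a + τ ≤ b - τ → Real.sqrt (∫ x in (a + τ)..(b - τ), F τ x ^ 2) ≤ m τ)
    {t : ℝ} (ht : 0 ≤ t) :
    ∫⁻ x in Ioi (a + t), ENNReal.ofReal
        (deriv (fun τ => ψ τ x) t ^ 2 + deriv (ψ t) x ^ 2 + V x * ψ t x ^ 2)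
      ≤ ENNReal.ofReal ((Real.sqrt (∫ x in Ioi a, (deriv (fun τ => ψ τ x) 0 ^ 2 + deriv (ψ 0) x ^ 2
          + V x * ψ 0 x ^ 2)) + 2 * ∫ τ in (0 : ℝ)..t, m τ) ^ 2) := by
  set E₀ : ℝ := ∫ x in Ioi a, (deriv (fun τ => ψ τ x) 0 ^ 2 + deriv (ψ 0) x ^ 2
    + V x * ψ 0 x ^ 2) with hE₀
  have hunion : Ioi (a + t) = ⋃ n : ℕ, Ioc (a + t) (a + t + n) := by
    ext x
    simp only [mem_iUnion, mem_Ioc, mem_Ioi]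
    constructor
    · intro h
      obtain ⟨n, hn⟩ := exists_nat_gt (x - (a + t))
      exact ⟨n, h, by linarith⟩
    · rintro ⟨n, h1, _⟩
      exact h1
  have hdir : Directed (· ⊆ ·) fun n : ℕ => Ioc (a + t) (a + t + n) :=
    Monotone.directed_le fun i j hij => Ioc_subset_Ioc le_rfl (by
      have : (i : ℝ) ≤ j := by exact_mod_cast hij
      linarith)
  rw [hunion, setLIntegral_iUnion_of_directed _ hdir]
  refine iSup_le fun n => ?_
  have hn0 : (0 : ℝ) ≤ n := n.cast_nonneg
  set b : ℝ := a + 2 * t + n with hb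
  have hD := wave1D_trapezoid_energy_le_of_data hV hV0 hF hψ hsol ht (a := a) (b := b)
    (by simp only [hb]; linarith)
  have htop : b - t = a + t + n := by simp only [hb]; ring
  rw [htop] at hD
  rw [lintegral_Ioc_wave1D_energy_eq hV hV0 hψ t (by linarith)]
  refine ENNReal.ofReal_le_ofReal (hD.trans ?_)
  -- data energy on `(a, b)` versus `(a, ∞)`
  have hab : a ≤ b := by simp only [hb]; linarith
  have hdata : (∫ x in a..b, (deriv (fun τ => ψ τ x) 0 ^ 2 + deriv (ψ 0) x ^ 2 + V x * ψ 0 x ^ 2))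
      ≤ E₀ := by
    rw [intervalIntegral.integral_of_le hab]
    exact setIntegral_mono_set hint (ae_of_all _ fun x => wave1D_energyDensity_nonneg hV0 0 x)
      (ae_of_all _ Ioc_subset_Ioi_self)
  have hdata0 : 0 ≤ ∫ x in a..b, (deriv (fun τ => ψ τ x) 0 ^ 2 + deriv (ψ 0) x ^ 2 + V x * ψ 0 x ^ 2) :=
    intervalIntegral.integral_nonneg hab fun x _ => wave1D_energyDensity_nonneg hV0 0 x
  -- source integrals
  set k : ℝ → ℝ := fun τ => Real.sqrt (∫ x in (a + τ)..(b - τ), F τ x ^ 2) with hk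
  have hF2 : Continuous (Function.uncurry fun τ x => F τ x ^ 2) := by
    show Continuous fun p : ℝ × ℝ => F p.1 p.2 ^ 2
    have : Continuous fun p : ℝ × ℝ => F p.1 p.2 := hF
    fun_prop
  have hkc : Continuous k := by
    have hP := intervalIntegral.continuous_parametric_primitive_of_continuous (μ := volume)
      (a₀ := (0 : ℝ)) hF2
    have c1 : Continuous fun τ : ℝ => ∫ x in (0 : ℝ)..(b - τ), F τ x ^ 2 :=
      hP.comp (continuous_id.prodMk (continuous_const.sub continuous_id))
    have c2 : Continuous fun τ : ℝ => ∫ x in (0 : ℝ)..(a + τ), F τ x ^ 2 :=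
      hP.comp (continuous_id.prodMk (continuous_const.add continuous_id))
    have heq : (fun τ => ∫ x in (a + τ)..(b - τ), F τ x ^ 2)
        = fun τ => (∫ x in (0 : ℝ)..(b - τ), F τ x ^ 2) - ∫ x in (0 : ℝ)..(a + τ), F τ x ^ 2 := by
      funext τ
      have hc : Continuous fun x => F τ x ^ 2 := hF2.comp (continuous_const.prodMk continuous_id)
      exact (integral_interval_sub_left (hc.intervalIntegrable _ _) (hc.intervalIntegrable _ _)).symm
    have hc : Continuous fun τ => ∫ x in (a + τ)..(b - τ), F τ x ^ 2 := by rw [heq]; exact c1.sub c2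
    exact Real.continuous_sqrt.comp hc
  have hkm : ∀ τ ∈ Icc 0 t, k τ ≤ m τ := fun τ hτ =>
    hmb τ hτ.1 b (by simp only [hb]; linarith [hτ.2])
  have hik : ∫ τ in (0 : ℝ)..t, k τ ≤ ∫ τ in (0 : ℝ)..t, m τ :=
    intervalIntegral.integral_mono_on ht (hkc.intervalIntegrable _ _) (hm.intervalIntegrable _ _) hkm
  have hik0 : 0 ≤ ∫ τ in (0 : ℝ)..t, k τ :=
    intervalIntegral.integral_nonneg ht fun τ _ => Real.sqrt_nonneg _
  have h1 : Real.sqrt (∫ x in a..b, (deriv (fun τ => ψ τ x) 0 ^ 2 + deriv (ψ 0) x ^ 2 + V x * ψ 0 x ^ 2))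
      + 2 * ∫ τ in (0 : ℝ)..t, k τ ≤ Real.sqrt E₀ + 2 * ∫ τ in (0 : ℝ)..t, m τ :=
    add_le_add (Real.sqrt_le_sqrt hdata) (by linarith)
  have h0 : 0 ≤ Real.sqrt (∫ x in a..b, (deriv (fun τ => ψ τ x) 0 ^ 2 + deriv (ψ 0) x ^ 2
      + V x * ψ 0 x ^ 2)) + 2 * ∫ τ in (0 : ℝ)..t, k τ := by positivity
  exact pow_le_pow_left₀ h0 h1 2

/-- **Far-cone energy bound with general data, backward in time** (`t ≤ 0`, cone `{x > a − t}`).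
[folklore] -/
theorem wave1D_farCone_energy_le_of_data_backward (hV : Continuous V) (hV0 : ∀ x, 0 ≤ V x)
    (hF : Continuous (Function.uncurry F)) (hψ : ContDiff ℝ 2 (Function.uncurry ψ))
    (hsol : ∀ t x, iteratedDeriv 2 (fun τ => ψ τ x) t - iteratedDeriv 2 (ψ t) x + V x * ψ t x
      = F t x)
    {a : ℝ} (hint : IntegrableOn (fun x => deriv (fun τ => ψ τ x) 0 ^ 2 + deriv (ψ 0) x ^ 2
      + V x * ψ 0 x ^ 2) (Ioi a))
    {m : ℝ → ℝ} (hm : Continuous m)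
    (hmb : ∀ τ, τ ≤ 0 → ∀ b, a - τ ≤ b + τ → Real.sqrt (∫ x in (a - τ)..(b + τ), F τ x ^ 2) ≤ m τ)
    {t : ℝ} (ht : t ≤ 0) :
    ∫⁻ x in Ioi (a - t), ENNReal.ofReal
        (deriv (fun τ => ψ τ x) t ^ 2 + deriv (ψ t) x ^ 2 + V x * ψ t x ^ 2)
      ≤ ENNReal.ofReal ((Real.sqrt (∫ x in Ioi a, (deriv (fun τ => ψ τ x) 0 ^ 2 + deriv (ψ 0) x ^ 2
          + V x * ψ 0 x ^ 2)) + 2 * ∫ τ in t..(0 : ℝ), m τ) ^ 2) := by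
  obtain ⟨hψ', hsol', he'⟩ := wave1D_timeReversal_source hψ hsol
  have hF' : Continuous (Function.uncurry fun t x => F (-t) x) := by
    have : (Function.uncurry fun t x => F (-t) x)
        = Function.uncurry F ∘ fun p : ℝ × ℝ => (-p.1, p.2) := by
      funext p; rfl
    rw [this]; exact hF.comp (continuous_neg.prodMap continuous_id)
  have hint' : IntegrableOn (fun x => deriv (fun τ => (fun t x => ψ (-t) x) τ x) 0 ^ 2
      + deriv ((fun t x => ψ (-t) x) 0) x ^ 2 + V x * (fun t x => ψ (-t) x) 0 x ^ 2) (Ioi a) := by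
    have : (fun x => deriv (fun τ => (fun t x => ψ (-t) x) τ x) 0 ^ 2
        + deriv ((fun t x => ψ (-t) x) 0) x ^ 2 + V x * (fun t x => ψ (-t) x) 0 x ^ 2)
        = fun x => deriv (fun τ => ψ τ x) 0 ^ 2 + deriv (ψ 0) x ^ 2 + V x * ψ 0 x ^ 2 := by
      funext x; rw [he' 0 x]; simp
    rw [this]; exact hint
  have hm' : Continuous fun τ => m (-τ) := hm.comp continuous_neg
  have hmb' : ∀ τ, 0 ≤ τ → ∀ b, a + τ ≤ b - τ →
      Real.sqrt (∫ x in (a + τ)..(b - τ), (fun t x => F (-t) x) τ x ^ 2) ≤ m (-τ) := by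
    intro τ hτ b hb
    have h := hmb (-τ) (by linarith) b (by linarith)
    simp only [sub_neg_eq_add, ← sub_eq_add_neg] at h
    simpa using h
  have h := wave1D_farCone_energy_le_of_data hV hV0 hF' hψ' hsol' hint' hm' hmb'
    (t := -t) (by linarith)
  simp only [he', neg_neg] at h
  have hI : ∫ τ in (0 : ℝ)..(-t), m (-τ) = ∫ τ in t..(0 : ℝ), m τ := by
    rw [intervalIntegral.integral_comp_neg (fun τ => m τ)]
    simp
  rw [hI] at h
  have hd0 : (fun x => deriv (fun τ => ψ τ x) (-0) ^ 2 + deriv (ψ (-0)) x ^ 2 + V x * ψ (-0) x ^ 2)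
      = fun x => deriv (fun τ => ψ τ x) 0 ^ 2 + deriv (ψ 0) x ^ 2 + V x * ψ 0 x ^ 2 := by
    funext x; simp
  simpa [sub_eq_add_neg, hd0] using h

end Literature.Analysis.PDE
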